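import Summits.QuantumFields.YangMills.Theorems.BalabanUVNodesN07DirectMethod
import Literature.MathematicalPhysics.QuantumFieldTheory.Balaban1983to89.B15DeterminingSets

/-!
# BalabanUVNodes ∕ N07 ([Balaban1985Variational] Theorem 1 (8) p. 279; [Balaban1988Convergent] (2.12) p. 256) — THE DIRECT METHOD FOR THE
# MULTI-SCALE VARIATIONAL PROBLEMS OF RECORD: over every CLOSED small-field class, the Wilson action attains its minimum on the fibre
# `{U : M_𝐁(U) = W}` of a DETERMINING-SET constraint (def-R's exact predicate `B15DeterminingSets.IsMinimizer` along `Node00.avOfRecord`)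

Track A of `YM-PLAN.md` (cell `pub-ymgap`, HUMAN RULING D-0062), DAG node **N07**; seat `pub-ymgap-dag-n07-e` (generation 5; module 13, the multi-scale
twin of module 11a `…N07DirectMethod` (p487790) offered to the K0′ ∕ ROW P11 desks (def-R, K0c, def-P11) on the bus; `--supports stmt-QuantumFields-19903
--as helper`).  THEOREMS ONLY (0 `def`, 0 `sorry`); nothing imported is modified.  Sources: [Balaban1985Variational] T. Bałaban, Commun. Math. Phys. **102**
(1985) 277–309, Thm 1 p. 279 («there exists a minimal orbit»); [Balaban1988Convergent] T. Bałaban, *Convergent renormalization expansions for lattice gauge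
theories*, Commun. Math. Phys. **119** (1988) 243–285, (2.10)–(2.12) p. 256 («A regular configuration V on 𝐁 determines the minimal orbit, i.e., the set of
minima, of the functional U → A^η(U) on U : U regular and M_𝐁(U) = V»).

CONTENT.  For the `K`-th torus of the family, a top scale `J`, a (53)-admissible radius `α₀` (`0 < α₀`, `C₀(d)α₀ ≤ ⅓`, `2α₀ ≤ c′₂`), a CLOSED class
`reg ⊆ bgReg F N K J α₀` (= `{|U(∂p) − 1| < α₀η_J²}`, so that EVERY average `Ū^j`, `j ≤ J`, is continuous on `reg` — module 11a's
`continuousAt_iter_avOfRecord_of_plaqSmall`), a determining set `𝔹` supported on scales `≤ J` and multi-scale data `W`: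
* `isClosed_inter_agreeOn` — the (2.10) constraint set `{U ∈ reg : M_𝔹(U) = W}` is CLOSED (finitely many bond equations `Ū^j(b) = W_j(b)`, each the
  preimage of a point under a map continuous on `reg`; K0c's `agreeOn_avgFamily_iff_fin`, p477287);
* ★ `exists_isMinimizer_of_isClosed` — if that set is non-empty, (2.12) HAS a minimal configuration over `reg`: `∃ U₀, IsMinimizer (avOfRecord F N K) reg 𝔹 W U₀`
  (compact × continuous, `IsCompact.exists_isMinOn`);
* `exists_isMinimizer_closure_plaqSmall` — the instance `reg := closure {PlaqSmall δ}`, `δ < α₀η_J²` (def-R's class (2.12) is the OPEN `{PlaqSmall δ}`);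
  `isMinimizer_of_isMinimizer_closure_of_mem` — an INTERIOR closed-class minimiser is a (2.12) minimiser over the open class: def-R's solvability
  `∃ U₀, IsMinimizer … {PlaqSmall δ} 𝔹 W U₀` ⟸ non-empty fibre + the displayed interiority of closed-class minimisers (`exists_isMinimizer_of_closureMinimisers_mem`);
* `exists_isMinimizer_atScale_iff` — consistency with module 11a: on the one-scale determining set `atScale k` this IS `∃ U₀, IsBackground … k (W k) U₀`
  (`B15DeterminingSets.isMinimizer_atScale_iff` BY NAME).

HONEST FRAMING.  Kernel theorems about the tree's own objects; NOTHING of Bałaban's asserted — the interiority of closed-class minimisers (the a-priori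
species of [Balaban1985Variational] Prop. 7 (ii) ∕ Sect. F) stays DISPLAYED wherever the OPEN class is wanted; no `Provisos₁₂` field, no ROW P11 clause is
inhabited here; K0′ ∕ N07 NOT discharged; COUNT-NEUTRAL (5∕27 unmoved); one finite four-torus programme at fixed `ε = L^{−K}` — NOT the continuum limit,
NOT ℝ⁴, NOT infinite volume, NOT OS, NOT a mass gap, NOT Clay.  No `instance`, no notation, 0 kit.
-/

noncomputable section

namespace Summit.QuantumFields.YangMills.BalabanUVNodes.N07DirectMethodDetSet

open Set Filter Topology
open Literature.MathematicalPhysics.QuantumFieldTheory.Balaban1983to89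
open Literature.MathematicalPhysics.QuantumFieldTheory.Balaban1983to89.T4Continuum (T4Family)
open Literature.MathematicalPhysics.QuantumFieldTheory.Balaban1983to89.Node00
open Literature.MathematicalPhysics.QuantumFieldTheory.Balaban1983to89.ExpMeanLog (deltaSU)
open Literature.MathematicalPhysics.QuantumFieldTheory.Balaban1983to89.B15DeterminingSets (DetSet MSField AgreeOn avgFamily bondsOf atScale
  IsMinimizer isMinimizer_atScale_iff)
open Summit.QuantumFields.YangMills.BalabanUVNodes.N07DirectMethod (continuousAt_iter_avOfRecord_of_plaqSmall isCompact_of_isClosed_cfg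
  continuous_wilsonAction4 closure_plaqSmall_subset_plaqSmall)
open scoped Matrix.Norms.L2Operator

variable {F : T4Family} {N : ℕ} [NeZero N]

/-- **THE (2.10) CONSTRAINT SET INSIDE A CLOSED SMALL-FIELD CLASS IS CLOSED.**  For a closed `reg ⊆ bgReg F N K J α₀` (`α₀` (53)-admissible), a
determining set `𝔹` supported on scales `≤ J` and data `W`: `{U ∈ reg : M_𝔹(U) = W on 𝔹}` is closed in `SU(N)^{bonds}` — the constraint is the finite
conjunction of the bond equations `Ū^j(b) = W_j(b)`, `j ≤ J`, `b ∈ bonds(Γ_j)` (`agreeOn_avgFamily_iff_fin`), each CLOSED on `reg` because `Ū^j` is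
continuous there (module 11a). [cite: Balaban1988Convergent, (2.10)–(2.11) p.256] -/
theorem isClosed_inter_agreeOn (K J : ℕ) {α₀ : ℝ} (hα : 0 < α₀)
    (hα3 : (143 * (((((F.P K).d + 4 : ℕ) : ℝ)) ^ 2 / 4) ^ 2) * α₀ ≤ 1 / 3)
    (hα2 : 2 * α₀ ≤ 2 * deltaSU (Fin N) / ((((F.P K).d + 4) * (F.P K).L : ℕ) : ℝ) ^ 2)
    {reg : Set (GaugeField (F.P K) 0 (SU N))} (hreg : IsClosed reg) (hsub : reg ⊆ bgReg F N K J α₀)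
    (𝔹 : DetSet (F.P K)) (h𝔹 : ∀ j, J < j → 𝔹 j = ∅) (W : MSField (F.P K) (SU N)) :
    IsClosed (reg ∩ {U | AgreeOn 𝔹 (avgFamily (avOfRecord F N K) U) W}) := by
  have hcont : ∀ j : ℕ, j ≤ J → ContinuousOn (Averaging.iter (avOfRecord F N K) j) reg := fun j hj U hU =>
    (continuousAt_iter_avOfRecord_of_plaqSmall K J hα hα3 hα2 ((mem_bgReg_iff F N K J α₀ U).1 (hsub hU)) j hj).continuousWithinAt
  have h1 : ∀ (j : Fin (J + 1)) (b : PBond (F.P K) j),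
      IsClosed (reg ∩ (fun U : GaugeField (F.P K) 0 (SU N) => Averaging.iter (avOfRecord F N K) j U b) ⁻¹' {W j b}) := by
    intro j b
    have hc : ContinuousOn (fun U : GaugeField (F.P K) 0 (SU N) => Averaging.iter (avOfRecord F N K) j U b) reg :=
      (continuous_apply b).comp_continuousOn (hcont j (Nat.lt_succ_iff.mp j.2))
    exact hc.preimage_isClosed_of_isClosed hreg isClosed_singleton
  have hS : reg ∩ {U | AgreeOn 𝔹 (avgFamily (avOfRecord F N K) U) W} =
      reg ∩ ⋂ j : Fin (J + 1), ⋂ b ∈ bondsOf (𝔹 j),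
        (reg ∩ (fun U : GaugeField (F.P K) 0 (SU N) => Averaging.iter (avOfRecord F N K) j U b) ⁻¹' {W j b}) := by
    ext U
    simp only [mem_inter_iff, mem_setOf_eq, mem_iInter, mem_preimage, mem_singleton_iff,
      agreeOn_avgFamily_iff_fin (avOfRecord F N K) h𝔹]
    exact ⟨fun ⟨hU, h⟩ => ⟨hU, fun j b hb => ⟨hU, h j b hb⟩⟩, fun ⟨hU, h⟩ => ⟨hU, fun j b hb => (h j b hb).2⟩⟩
  rw [hS]
  exact hreg.inter (isClosed_iInter fun j => isClosed_biInter fun b _ => h1 j b)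

/-- ★ **THE DIRECT METHOD FOR [III] (2.12) AT NODE 00's OBJECTS.**  On the finest torus of the `K`-th approximation: for a CLOSED class `reg ⊆ bgReg F N K J α₀`
(`α₀` (53)-admissible), a determining set `𝔹` supported on scales `≤ J`, and data `W` whose fibre `{U ∈ reg : M_𝔹(U) = W}` is non-empty, the functional
`U ↦ A^η(U)` ATTAINS its minimum on that fibre — a minimal configuration in def-R's exact sense: `∃ U₀, IsMinimizer (avOfRecord F N K) reg 𝔹 W U₀`
(compact fibre × continuous action; print obtains the minimiser from [Balaban1985Variational] Thm 1). [cite: Balaban1988Convergent, (2.12) p.256; Balaban1985Variational, Thm 1 (8) p.279] -/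
theorem exists_isMinimizer_of_isClosed (K J : ℕ) {α₀ : ℝ} (hα : 0 < α₀)
    (hα3 : (143 * (((((F.P K).d + 4 : ℕ) : ℝ)) ^ 2 / 4) ^ 2) * α₀ ≤ 1 / 3)
    (hα2 : 2 * α₀ ≤ 2 * deltaSU (Fin N) / ((((F.P K).d + 4) * (F.P K).L : ℕ) : ℝ) ^ 2)
    {reg : Set (GaugeField (F.P K) 0 (SU N))} (hreg : IsClosed reg) (hsub : reg ⊆ bgReg F N K J α₀)
    (𝔹 : DetSet (F.P K)) (h𝔹 : ∀ j, J < j → 𝔹 j = ∅) {W : MSField (F.P K) (SU N)}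
    (hne : ∃ U ∈ reg, AgreeOn 𝔹 (avgFamily (avOfRecord F N K) U) W) :
    ∃ U₀ : GaugeField (F.P K) 0 (SU N), IsMinimizer (avOfRecord F N K) reg 𝔹 W U₀ := by
  have hSc := isClosed_inter_agreeOn K J hα hα3 hα2 hreg hsub 𝔹 h𝔹 W
  have hSne : (reg ∩ {U | AgreeOn 𝔹 (avgFamily (avOfRecord F N K) U) W}).Nonempty := by
    obtain ⟨U, hU, hA⟩ := hne
    exact ⟨U, hU, hA⟩
  obtain ⟨U₀, hU₀S, hmin⟩ := (isCompact_of_isClosed_cfg hSc).exists_isMinOn hSne continuous_wilsonAction4.continuousOn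
  exact ⟨U₀, hU₀S.1, hU₀S.2, fun U hU hA => (isMinOn_iff.1 hmin) U ⟨hU, hA⟩⟩

/-- **The instance for def-R's class**: over the CLOSURE of the (2.12) regularity class `{U | |U(∂p) − 1| < δ ∀p}`, `δ < α₀η_J²` (`α₀` (53)-admissible;
the closure lies in `bgReg F N K J α₀`, module 11a), every non-empty fibre of a determining set supported on scales `≤ J` carries a minimal configuration.
[cite: Balaban1988Convergent, (2.12) p.256] -/
theorem exists_isMinimizer_closure_plaqSmall (K J : ℕ) {δ α₀ : ℝ} (hδ : δ < α₀ * (F.P K).eta J ^ 2) (hα : 0 < α₀)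
    (hα3 : (143 * (((((F.P K).d + 4 : ℕ) : ℝ)) ^ 2 / 4) ^ 2) * α₀ ≤ 1 / 3)
    (hα2 : 2 * α₀ ≤ 2 * deltaSU (Fin N) / ((((F.P K).d + 4) * (F.P K).L : ℕ) : ℝ) ^ 2)
    (𝔹 : DetSet (F.P K)) (h𝔹 : ∀ j, J < j → 𝔹 j = ∅) {W : MSField (F.P K) (SU N)}
    (hne : ∃ U : GaugeField (F.P K) 0 (SU N), PlaqSmall δ U ∧ AgreeOn 𝔹 (avgFamily (avOfRecord F N K) U) W) :
    ∃ U₀ : GaugeField (F.P K) 0 (SU N),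
      IsMinimizer (avOfRecord F N K) (closure {U : GaugeField (F.P K) 0 (SU N) | PlaqSmall δ U}) 𝔹 W U₀ :=
  exists_isMinimizer_of_isClosed K J hα hα3 hα2 isClosed_closure (closure_plaqSmall_subset_plaqSmall hδ) 𝔹 h𝔹
    (hne.imp fun _ ⟨hU, hA⟩ => ⟨subset_closure hU, hA⟩)

/-- **AN INTERIOR CLOSED-CLASS MINIMISER IS A (2.12) MINIMISER OVER THE OPEN CLASS** (the open class is part of its closure).
[cite: Balaban1988Convergent, (2.12) p.256 (bookkeeping)] -/
theorem isMinimizer_of_isMinimizer_closure_of_mem {K : ℕ} {reg : Set (GaugeField (F.P K) 0 (SU N))} {𝔹 : DetSet (F.P K)}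
    {W : MSField (F.P K) (SU N)} {U₀ : GaugeField (F.P K) 0 (SU N)}
    (h : IsMinimizer (avOfRecord F N K) (closure reg) 𝔹 W U₀) (hU₀ : U₀ ∈ reg) :
    IsMinimizer (avOfRecord F N K) reg 𝔹 W U₀ :=
  ⟨hU₀, h.2.1, fun U hU hA => h.2.2 U (subset_closure hU) hA⟩

/-- **def-R's SOLVABILITY OF (2.12) OVER THE OPEN CLASS ⟸ INTERIORITY**: if the open-class fibre `{PlaqSmall δ} ∩ {M_𝔹 = W}` is non-empty and every
minimal configuration over the CLOSED class lies in the OPEN class (the displayed a-priori sentence — species of [Balaban1985Variational] Prop. 7 (ii) ∕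
Sect. F), then `∃ U₀, IsMinimizer (avOfRecord F N K) {PlaqSmall δ} 𝔹 W U₀` (`δ < α₀η_J²`, `α₀` (53)-admissible, `𝔹` on scales `≤ J`).
[cite: Balaban1988Convergent, (2.12) p.256; Balaban1985Variational, Thm 1 (8) p.279] -/
theorem exists_isMinimizer_of_closureMinimisers_mem (K J : ℕ) {δ α₀ : ℝ} (hδ : δ < α₀ * (F.P K).eta J ^ 2) (hα : 0 < α₀)
    (hα3 : (143 * (((((F.P K).d + 4 : ℕ) : ℝ)) ^ 2 / 4) ^ 2) * α₀ ≤ 1 / 3)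
    (hα2 : 2 * α₀ ≤ 2 * deltaSU (Fin N) / ((((F.P K).d + 4) * (F.P K).L : ℕ) : ℝ) ^ 2)
    (𝔹 : DetSet (F.P K)) (h𝔹 : ∀ j, J < j → 𝔹 j = ∅) {W : MSField (F.P K) (SU N)}
    (hne : ∃ U : GaugeField (F.P K) 0 (SU N), PlaqSmall δ U ∧ AgreeOn 𝔹 (avgFamily (avOfRecord F N K) U) W)
    (hint : ∀ U₀ : GaugeField (F.P K) 0 (SU N),
      IsMinimizer (avOfRecord F N K) (closure {U : GaugeField (F.P K) 0 (SU N) | PlaqSmall δ U}) 𝔹 W U₀ → PlaqSmall δ U₀) :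
    ∃ U₀ : GaugeField (F.P K) 0 (SU N), IsMinimizer (avOfRecord F N K) {U : GaugeField (F.P K) 0 (SU N) | PlaqSmall δ U} 𝔹 W U₀ := by
  obtain ⟨U₀, h⟩ := exists_isMinimizer_closure_plaqSmall K J hδ hα hα3 hα2 𝔹 h𝔹 hne
  exact ⟨U₀, isMinimizer_of_isMinimizer_closure_of_mem h (hint U₀ h)⟩

/-- **CONSISTENCY WITH MODULE 11a**: on the one-scale determining set `atScale k` («everything at scale `k`», [I] (0.21)) a minimal configuration in
def-R's sense IS a background in `Setup.IsBackground`'s sense at the datum `W k` (`B15DeterminingSets.isMinimizer_atScale_iff` BY NAME), so §'s existence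
statements over `atScale k` are module 11a's. [cite: Balaban1987RG1, (0.21) p.256; Balaban1988Convergent, (2.13) p.257] -/
theorem exists_isMinimizer_atScale_iff {K : ℕ} (reg : Set (GaugeField (F.P K) 0 (SU N))) (k : ℕ) (W : MSField (F.P K) (SU N)) :
    (∃ U₀ : GaugeField (F.P K) 0 (SU N), IsMinimizer (avOfRecord F N K) reg (atScale k) W U₀) ↔
      ∃ U₀ : GaugeField (F.P K) 0 (SU N), IsBackground (avOfRecord F N K) reg k (W k) U₀ :=
  exists_congr fun U₀ => isMinimizer_atScale_iff (avOfRecord F N K) reg k W U₀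

end Summit.QuantumFields.YangMills.BalabanUVNodes.N07DirectMethodDetSet

end
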